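import Summits.HubbardSuperconductivity.HubbardSuperconductivity.Theses.ThermalWedge
import Summits.HubbardSuperconductivity.HubbardSuperconductivity.Theorems.ThermalWedgeTwSeededRungStructural

/-!
# Route `ThermalWedge` — `TwSeededRung` (stmt-HubbardSuperconductivity-1699) from the NARROWED
seeded ensemble equivalence

Companion of `ThermalWedgeTwSeededRung.lean` (`twSeededRung_of_condensation :
TwSourcedCondensation → TwSeededEnsembleEquivalence → TwSeededRung`) and of the route-file-free
engine `ThermalWedgeTwSeededRungStructural.lean` (`twSeededRung_structural`). Here, against the
route's declarations:

* `tw_narrowEnsembleEquivalence_of`: `TwSeededEnsembleEquivalence` implies its narrowing to the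
  thermal window `1 ≤ β ≤ e^{a/U}` (every `a > 0`, `U₀ = U₀(δ,a)`, `μ`-window before `a`) — the
  restatement recommended by the standing disprover of stmt-HubbardSuperconductivity-1698
  (`Cruxes/TwSeededEnsembleEquivalence/Disproof.lean`, `CruxNarrow`);
* `twSeededRung_of_narrowEnsembleEquivalence`: narrowed ensemble equivalence + `TwSourcedCondensation`
  ⟹ `TwSeededRung` (an instance of the engine; by the first lemma it re-proves
  `twSeededRung_of_condensation`).

The closing theorem of stmt-1699 should be assembled from the ENGINE in a module that does not
import this route file, so that it can be linked as `TwSeededRung_holds`.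
-/

namespace Summit.HubbardSuperconductivity.HubbardSuperconductivity.Theorems

open Literature.MathematicalPhysics.QuantumLattice Matrix
open Summit.HubbardSuperconductivity.HubbardSuperconductivity.Theses.ThermalWedge

/-- `TwSeededEnsembleEquivalence` implies its NARROWING to the thermal window `1 ≤ β ≤ e^{a/U}`
(for every `a > 0`, thresholds `U₀(δ,a)`, `μ`-window chosen before `a`): drop the cap on `β`. -/
theorem tw_narrowEnsembleEquivalence_of (hEns : TwSeededEnsembleEquivalence) :
    ∀ δ ∈ Set.Icc (1/10 : ℝ) (2/5 : ℝ), ∃ μ₁ μ₂ : ℝ, -4 < μ₁ ∧ μ₁ ≤ μ₂ ∧ μ₂ < 0 ∧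
      ∀ a : ℝ, 0 < a → ∃ U₀ : ℝ, 0 < U₀ ∧ ∀ U ∈ Set.Ioc (0 : ℝ) U₀, ∀ g ∈ Set.Ioc (0 : ℝ) (1 / 10),
        ∀ β : ℝ, 1 ≤ β → β ≤ Real.exp (a / U) → ∃ μ ∈ Set.Icc μ₁ μ₂, ∀ ε : ℝ, 0 < ε → ∃ L₀ : ℕ,
          ∀ (L : ℕ) [NeZero L], L₀ ≤ L →
            ((hubbardTorus 2 L 1 U - ((g / (L : ℝ) ^ 2 : ℝ) : ℂ) •
              ((pairField dWaveFormFactor L)ᴴ * pairField dWaveFormFactor L)).minEnergyOn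
                (szSector (Λ := FermionTorus 2 L) (2 * ⌊(1 - δ) * (L : ℝ) ^ 2 / 2⌋₊) 0) /
                  (L : ℝ) ^ 2) +
              (Real.log (Matrix.partitionFn β (hubbardTorusWith 2 L 1 U μ -
                ((g / (L : ℝ) ^ 2 : ℝ) : ℂ) •
                  ((pairField dWaveFormFactor L)ᴴ * pairField dWaveFormFactor L))).re /
                    (β * (L : ℝ) ^ 2)) -
              μ * ((2 * ⌊(1 - δ) * (L : ℝ) ^ 2 / 2⌋₊) : ℝ) / (L : ℝ) ^ 2 ≤ Real.log 4 / β + ε := by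
  intro δ hδ
  obtain ⟨μ₁, μ₂, hμ₁, hμ₁₂, hμ₂, U₀, hU₀, hU⟩ := hEns δ hδ
  exact ⟨μ₁, μ₂, hμ₁, hμ₁₂, hμ₂, fun a _ => ⟨U₀, hU₀, fun U hUm g hg β hβ _ => hU U hUm g hg β hβ⟩⟩

/-- **The anchor from the NARROWED seeded ensemble equivalence and sourced condensation**, against
the route's declarations (an instance of the route-file-free engine `twSeededRung_structural`). -/
theorem twSeededRung_of_narrowEnsembleEquivalence
    (hEns : ∀ δ ∈ Set.Icc (1/10 : ℝ) (2/5 : ℝ), ∃ μ₁ μ₂ : ℝ, -4 < μ₁ ∧ μ₁ ≤ μ₂ ∧ μ₂ < 0 ∧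
      ∀ a : ℝ, 0 < a → ∃ U₀ : ℝ, 0 < U₀ ∧ ∀ U ∈ Set.Ioc (0 : ℝ) U₀, ∀ g ∈ Set.Ioc (0 : ℝ) (1 / 10),
        ∀ β : ℝ, 1 ≤ β → β ≤ Real.exp (a / U) → ∃ μ ∈ Set.Icc μ₁ μ₂, ∀ ε : ℝ, 0 < ε → ∃ L₀ : ℕ,
          ∀ (L : ℕ) [NeZero L], L₀ ≤ L →
            ((hubbardTorus 2 L 1 U - ((g / (L : ℝ) ^ 2 : ℝ) : ℂ) •
              ((pairField dWaveFormFactor L)ᴴ * pairField dWaveFormFactor L)).minEnergyOn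
                (szSector (Λ := FermionTorus 2 L) (2 * ⌊(1 - δ) * (L : ℝ) ^ 2 / 2⌋₊) 0) /
                  (L : ℝ) ^ 2) +
              (Real.log (Matrix.partitionFn β (hubbardTorusWith 2 L 1 U μ -
                ((g / (L : ℝ) ^ 2 : ℝ) : ℂ) •
                  ((pairField dWaveFormFactor L)ᴴ * pairField dWaveFormFactor L))).re /
                    (β * (L : ℝ) ^ 2)) -
              μ * ((2 * ⌊(1 - δ) * (L : ℝ) ^ 2 / 2⌋₊) : ℝ) / (L : ℝ) ^ 2 ≤ Real.log 4 / β + ε)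
    (hCond : TwSourcedCondensation) : TwSeededRung :=
  twSeededRung_structural hEns hCond

-- The landed `twSeededRung_of_condensation` factors through the engine (the two proofs agree;
-- an `example`, so as not to duplicate the declaration).
example (hCond : TwSourcedCondensation) (hEns : TwSeededEnsembleEquivalence) : TwSeededRung :=
  twSeededRung_of_narrowEnsembleEquivalence (tw_narrowEnsembleEquivalence_of hEns) hCond

end Summit.HubbardSuperconductivity.HubbardSuperconductivity.Theorems
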